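/-
Copyright (c) 2026 the pub-hodgecm2 formalisation cell (harness21).  New file, outside the frozen port manifest.
Origin: seat `prover-pub-hodgecm2-d2bridge-prove-2-g0-0` (unit pub-hodgecm2-d2bridge-prove-2, Δ2 BRIDGE team; COORDINATOR «Δ2 RESTRUCTURE
FOR SPEED» pub-hodgecm2/INBOX l.10757: prove-2 = sublemma S2 of the statement seat's skeleton `HOME/d2bridge/HcmSkeleton.lean`), 2026-08-23.
Definitions + theorems; no named fact, no `sorry`, no new axiom; count-neutral; HC_CM is NOT proved; «Δ2 BRIDGE CLOSED» is NOT claimed.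
-/
import Literature.NumberTheory.Automorphic.Liu2021.AppendixC.RestOneHecke
import Literature.NumberTheory.Automorphic.Liu2021.Thm418ProofMapRational
import HarnessLib

set_option autoImplicit false

/-!
# Δ2 bridge, sublemma S2: the proof's pull-back map (4.2) on the REAL `Ω(μ) = colim_K Hom_E(A_K, A_μ)_ℚ`, CONSTRUCTED level-wise,
# with its level-`K` law `P_eq`

Y. Liu, *Fourier–Jacobi cycles and arithmetic relative trace formula*, Camb. J. Math. **9** (2021) 1–147 = arXiv:2102.11518 [Liu2021];
TeX source `FJcycle.tex` (md5 `6db49a74122d…`; `l. NNNN` = its lines).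

## What this file is

The Δ2 skeleton (`HOME/d2bridge/HcmSkeleton.lean`, statement seat; assembler's `HcmPieces.lean`) splits the CM-side contract `hcm` of the
bridge «[Liu2021] Thm. 4.18 AS PRINTED ⟹ the package reading `Thm418C`» into S1–S4.  **S2** (this seat) is the group
`AK ∕ phiStar ∕ transK` with the law

  `P_eq : ∀ φ, M.ι ((M.P (D.res K M.Dμ φ)).baseChange ℂ M.α) = transK (phiStar φ M.α)`

— «the record's pull-back `P` IS Betti pull-back along the REAL morphism `φ : A_K → A_μ` followed by `A_∞ → A_K`; at the pin a
CONSTRUCTION LAW of the record `M`» ([Liu2021] Rem. 4.17, l. 2226–2228: `Hom_E(A_∞, A_μ)_ℚ ≅ Ω(μ)`; proof of Thm. 4.18, l. 2248–2250: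
«identify `Ω(μ)` with `Hom_E(A_∞, A_μ)_ℚ` by Remark 4.17 … we obtain a map `Ω(μ) → H¹_{B,τ'}(A_∞, ℂ)` by pulling back `α`»; §4.2
l. 2070–2072: `A_∞ := lim_K A_K`).  The record `M : Map43RationalData` of the proof's objects AT THE PIN (BRIDGE-PLAN S4, binder group
R2 `M ∕ jH ∕ hjHinj ∕ hjH`) does not exist yet (port-gated); but its field `P : Ω(μ) →+ (H¹_{B,τ'}(A_μ, ℚ) →ₗ[ℚ] H¹_{B,τ'}(A_∞, ℚ))`
must be DEFINED on the REAL `Ω(μ)` of the tree's one-object rest `restOne` (`Liu2021/AppendixC/RestOne.lean`):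
`ΩOne = Π_{D} colim_K ℚ ⊗_ℤ Hom_E(A_K, A_μ)` (`Module.DirectLimit` over the sufficiently small levels, `res_K = DirectLimit.of`).
THIS FILE supplies that definition and its law, hole-free and generic:

* §0  `DirectLimit.liftAddMonoidHom` — ADDITIVE maps out of a `Module.DirectLimit` (Mathlib's `lift` wants linearity over the ring of the
  limit; `P` is only additive on `Ω(μ)`, its `M_μ`-linearity being the separate law `P_smul`) [folklore];
* §1  `LevelwiseBettiPullback C B L U` — the PIN's primitive data: per level `K` a `ℚ`-space `AKQ K` (= `H¹_B(A_K ⊗_{E,ι₁} ℂ; ℚ)`), the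
  pull-back `phiStarQ K : Hom_E(A_K, B) →+ (L →ₗ[ℚ] AKQ K)` along REAL morphisms (`L` = `H¹_B(B ⊗ ℂ; ℚ)`; Betti functoriality), pull-backs
  `pbQ u` along morphisms `A_{K'} → A_K` with functoriality `phiStarQ_comp`, and the structure maps `transKQ K : AKQ K →ₗ[ℚ] U` of the rational
  tower `U = H¹_{B,τ'}(A_∞, ℚ)` with the cocone law `transKQ_Atr`; from these, `phiStarQHom` (the `ℚ`-linear extension to `ℚ ⊗_ℤ Hom`) and THE MAP
  `PΩ : ΩOf C B S →+ (L →ₗ[ℚ] U)` by the universal property, with `PΩ_resOf : PΩ (res_K t) = transKQ K ∘ phiStarQHom K t`;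
* §2  at the one-object rest: `PΩOne` on `ΩOne` and its law in the `toThm418Data C (restOne …)` currency (`PΩOne_res`);
* §3  **S2 in the skeleton's shape**: for ANY record `M` over `toThm418Data C (restOne …)` whose `P` is `PΩOne` (`hMP`), the fields
  `AK := ℂ ⊗_ℚ AKQ (levelOf K)`, `phiStar φ := (phiStarQHom (levelOf K) φ) ⊗ ℂ`, `transK := M.ι ∘ (transKQ (levelOf K)) ⊗ ℂ` satisfy `P_eq`
  (`map42_P_eq`).  The interface `AK ∕ transK` is the one S3 (`tower_eq`) and S4 (`geom_eq`) are stated against;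
* the remaining laws of `Map43RationalData` that concern `P` — `P_smul` («`M_μ` acts via `i_μ`»), `P_injective` (faithfulness) and
  `P_comm` (Hecke equivariance for the CONSTRUCTED action of `AppendixC/RestOneHecke.lean`) — are reduced to level-wise Betti primitives
  for THIS construction in the sibling `OmegaLevelwisePullbackLaws.lean` (same seat).

WHAT THE PIN STILL SUPPLIES (after BURST-2; not constructible hole-free today): `AKQ K := bettiCohomology` of `A_K ⊗_{E,ι₁} ℂ` in degree 1
over `ℚ` (tree `Literature.AlgebraicGeometry.Motives.bettiCohomology`, the S3 currency), `phiStarQ ∕ pbQ` := its functoriality,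
`transKQ` := the structure maps of the model's tower read on `A_K` through Lem. 2.4 (1), and the remaining laws of `Map43RationalData`
for the record built with `P := PΩOne` (reduced to pin primitives in the sibling `…Laws` file).  Nothing about Liu's objects is asserted here; HC_CM is NOT
proved; «Δ2 BRIDGE CLOSED» is NOT claimed.

## References
* [Liu2021] §4.2 l. 2062–2081 (`A_K = Alb_{X_K}`, `A_∞ := lim_K A_K`, `H¹_{B,τ'}(A_∞, ℂ) := colim_K H¹_{B,τ'}(A_K, ℂ)`); Def. 4.16 and
  Rem. 4.17 (l. 2215–2228); Thm. 4.18 (1) (l. 2239); proof of Thm. 4.18, map (4.2)/(4.3) (l. 2247–2253); Lem. 2.4 (1) (l. 1210–1213).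
* Tree: `Liu2021/AppendixC/RestOne.lean` (`QHom`, `pre`, `ΩOf`, `resOf`, `ΩOne`, `resOne`, `restOne`), `Liu2021/AppendixC/RestOneHecke.lean`
  (`HeckeTranslates.hecke ∕ heckeRep ∕ rhoΩOne`, `hecke_resOf`), `Liu2021/AppendixC/Glue.lean`
  (`Sec42Data`, `HomQ`, `levelOf`, `toThm418Data`), `Liu2021/Thm418ProofMapRational.lean` (`Map43RationalData`).
-/

noncomputable section

open scoped TensorProduct
open CategoryTheory NumberField
open Literature.AlgebraicGeometry.Motives (AbelianVariety)

namespace Summit.HodgeConjecture.CorCM.D2Bridge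

universe u v w

/-! ## §0  Additive maps out of a module direct limit -/

section LiftAdd

variable {R : Type u} [Semiring R] {ι : Type v} [Preorder ι] [DecidableEq ι] {G : ι → Type w}
  [∀ i, AddCommMonoid (G i)] [∀ i, Module R (G i)] (f : ∀ i j, i ≤ j → G i →ₗ[R] G j)
  {P : Type*} [AddCommMonoid P]

/-- **Universal property of `Module.DirectLimit` for ADDITIVE maps.**  A family of additive maps `g i : G i →+ P` into an additive
monoid `P` (no `R`-module structure asked on `P`) that respects the directed system descends to `colim_i G i →+ P` — as Mathlib's
`Module.DirectLimit.lift`, whose congruence is the additive congruence generated by the relations `ι_i x ∼ ι_j (f x)`. [folklore] -/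
def DirectLimit.liftAddMonoidHom (g : ∀ i, G i →+ P) (Hg : ∀ i j hij x, g j (f i j hij x) = g i x) :
    Module.DirectLimit G f →+ P :=
  AddCon.lift (Module.DirectLimit.moduleCon f).toAddCon (DirectSum.toAddMonoid g) <|
    AddCon.addConGen_le.2 fun _ _ ⟨_, _⟩ => by
      simpa [DirectSum.lof_eq_of, DirectSum.toAddMonoid_of] using (Hg _ _ _ _).symm

/-- The descended map on a component is the given one. [folklore] -/
@[simp] theorem DirectLimit.liftAddMonoidHom_of (g : ∀ i, G i →+ P) (Hg : ∀ i j hij x, g j (f i j hij x) = g i x)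
    (i : ι) (x : G i) :
    DirectLimit.liftAddMonoidHom f g Hg (Module.DirectLimit.of R ι G f i x) = g i x :=
  DirectSum.toAddMonoid_of g i x

end LiftAdd

/-! ## §1  Level-wise Betti pull-back data and the map (4.2) on `Ω = colim_K ℚ ⊗_ℤ Hom_E(A_K, B)` -/

section Levelwise

open Literature.NumberTheory.Automorphic Literature.NumberTheory.Automorphic.Liu2021 Literature.NumberTheory.Automorphic.Liu2021.AppendixC
open Literature.NumberTheory.Automorphic.Liu2021.AppendixC.RestOne

variable {F E : Type} [Field F] [NumberField F] [IsTotallyReal F] [Field E] [NumberField E] [Algebra F E]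
  [IsTotallyComplex E] [Algebra.IsQuadraticExtension F E]
variable {P5 : PropC5Data F E} {isotropicAt : ℕ → Prop} (C : Sec42Data P5 isotropicAt) (B : AbelianVariety E)

/-- **The PIN's primitive data for the proof's pull-back (4.2)** ([Liu2021] proof of Thm. 4.18, l. 2248–2250, with §4.2 l. 2062–2081),
over the Appendix-C datum `C` (its Albanese projective system `K ↦ A_K = Alb_{X_K}` with transitions `Atr`) and an abelian variety `B`
over `E` (= `A_μ`): for every sufficiently small level `K` a `ℚ`-space `AKQ K` standing for `H¹_B(A_K ⊗_{E,ι₁} ℂ; ℚ)`; the pull-back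
`phiStarQ K φ : L → AKQ K` along a REAL morphism `φ : A_K → B` (`L` standing for `H¹_B(B ⊗_{E,ι₁} ℂ; ℚ)`), additive in `φ`; the pull-back
`pbQ u = u^*` along any morphism `u : A_{K'} → A_K` with FUNCTORIALITY `(u ≫ φ)^* = u^* ∘ φ^*`; and the structure maps `transKQ K : AKQ K → U`
of the rational tower `U` standing for `H¹_{B,τ'}(A_∞, ℚ) = colim_K H¹_{B,τ'}(A_K, ℚ)` with the cocone law along the transitions `Alb(u^{K'}_K)`.  Nothing is asserted: at the pin every
field is an honest Betti object / functoriality theorem (tree `Motives.bettiCohomology`). [cite: Liu2021, §4.2 (FJcycle.tex l. 2062–2081) and proof of Thm. 4.18 (l. 2248–2250)] -/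
structure LevelwiseBettiPullback (L : Type) [AddCommGroup L] [Module ℚ L] (U : Type) [AddCommGroup U] [Module ℚ U] :
    Type 1 where
  /-- ⟨pin⟩ `H¹_B(A_K ⊗_{E,ι₁} ℂ; ℚ)` at the level `K`. -/
  AKQ : C5.SmallLevel C.S.K₀ → Type
  [instAKQ₁ : ∀ K, AddCommGroup (AKQ K)]
  [instAKQ₂ : ∀ K, Module ℚ (AKQ K)]
  /-- ⟨pin⟩ `φ ↦ φ^*`, Betti pull-back along a REAL morphism `φ : A_K → B`, additive in `φ`. -/
  phiStarQ : ∀ K : C5.SmallLevel C.S.K₀, (C.A K ⟶ B) →+ (L →ₗ[ℚ] AKQ K)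
  /-- ⟨pin⟩ `u^* : H¹(A_K) → H¹(A_{K'})`, Betti pull-back along ANY morphism `u : A_{K'} → A_K` between the Albanese varieties of the
  system (the transitions `Alb(u^{K'}_K)` of the projective system AND the Hecke translates `Alb(T_g)`, l. 2070–2074). -/
  pbQ : ∀ {K K' : C5.SmallLevel C.S.K₀}, (C.A K' ⟶ C.A K) → (AKQ K →ₗ[ℚ] AKQ K')
  /-- ⟨pin law⟩ functoriality of Betti `H¹`: `(u ≫ φ)^* = u^* ∘ φ^*`. -/
  phiStarQ_comp : ∀ {K K' : C5.SmallLevel C.S.K₀} (u : C.A K' ⟶ C.A K) (φ : C.A K ⟶ B),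
    phiStarQ K' (u ≫ φ) = pbQ u ∘ₗ phiStarQ K φ
  /-- ⟨pin⟩ the structure map `H¹_{B,τ'}(A_K, ℚ) → H¹_{B,τ'}(A_∞, ℚ) = U` of the rational tower. -/
  transKQ : ∀ K : C5.SmallLevel C.S.K₀, AKQ K →ₗ[ℚ] U
  /-- ⟨pin law⟩ the cocone law of the tower along the projective system: `transK' ∘ Alb(u^{K'}_K)^* = transK` for `K' ⊆ K`. -/
  transKQ_Atr : ∀ {K K' : C5.SmallLevel C.S.K₀} (f : K' ⟶ K), transKQ K' ∘ₗ pbQ (C.Atr f) = transKQ K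

attribute [instance] LevelwiseBettiPullback.instAKQ₁ LevelwiseBettiPullback.instAKQ₂

namespace LevelwiseBettiPullback

variable {C B} {L : Type} [AddCommGroup L] [Module ℚ L] {U : Type} [AddCommGroup U] [Module ℚ U]
  (Λ : LevelwiseBettiPullback C B L U)

/-- `φ ↦ φ^*` extended `ℚ`-linearly to `Hom_E(A_K, B)_ℚ = ℚ ⊗_ℤ Hom_E(A_K, B)`: `q ⊗ φ ↦ q · φ^*` (Mathlib `LinearMap.liftBaseChange`).
[cite: Liu2021, Thm. 4.18 (1) (FJcycle.tex l. 2239) with proof l. 2248–2250] -/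
def phiStarQHom (K : C5.SmallLevel C.S.K₀) : C.HomQ K B →ₗ[ℚ] (L →ₗ[ℚ] Λ.AKQ K) :=
  ((Λ.phiStarQ K).toIntLinearMap).liftBaseChange ℚ

/-- `phiStarQHom K (q ⊗ φ) = q • φ^*`.  Unfolding, ours. [cite: Liu2021, proof of Thm. 4.18 (FJcycle.tex l. 2248–2250)] -/
@[simp] theorem phiStarQHom_tmul (K : C5.SmallLevel C.S.K₀) (q : ℚ) (φ : C.A K ⟶ B) :
    Λ.phiStarQHom K (q ⊗ₜ φ) = q • Λ.phiStarQ K φ :=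
  rfl

/-- The level-`K` piece of (4.2) into the tower: `t ↦ transK ∘ t^*` on `Hom_E(A_K, B)_ℚ`, additive. [cite: Liu2021, proof of Thm. 4.18 (FJcycle.tex l. 2248–2250)] -/
def levelMap (K : C5.SmallLevel C.S.K₀) : C.HomQ K B →+ (L →ₗ[ℚ] U) where
  toFun t := Λ.transKQ K ∘ₗ Λ.phiStarQHom K t
  map_zero' := by rw [map_zero, LinearMap.comp_zero]
  map_add' t t' := by rw [map_add, LinearMap.comp_add]

/-- `levelMap K t = transK ∘ phiStarQHom K t`.  Unfolding, ours. [cite: Liu2021, proof of Thm. 4.18 (FJcycle.tex l. 2248–2250)] -/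
theorem levelMap_apply (K : C5.SmallLevel C.S.K₀) (t : C.HomQ K B) :
    Λ.levelMap K t = Λ.transKQ K ∘ₗ Λ.phiStarQHom K t :=
  rfl

/-- Compatibility of the level pieces with the pull-back `pre (Alb u)` of the inductive system `{Hom_E(A_K, B)_ℚ}_K` (functoriality
`phiStarQ_comp` + the cocone law `transKQ_Atr`). [cite: Liu2021, §4.2 (FJcycle.tex l. 2070–2072)] -/
theorem levelMap_pre {K K' : C5.SmallLevel C.S.K₀} (u : K' ⟶ K) (t : C.HomQ K B) :
    Λ.levelMap K' (pre B (C.Atr u) t) = Λ.levelMap K t := by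
  induction t using TensorProduct.induction_on with
  | zero => rw [map_zero, map_zero, map_zero]
  | tmul q φ =>
    rw [pre_tmul, levelMap_apply, levelMap_apply, phiStarQHom_tmul, phiStarQHom_tmul, Λ.phiStarQ_comp,
      LinearMap.comp_smul, LinearMap.comp_smul, ← LinearMap.comp_assoc, Λ.transKQ_Atr]
  | add t t' ht ht' => rw [map_add, map_add, map_add, ht, ht']

variable (S : Type) [Ring S] [EndScalar S B]

open scoped Classical in
/-- **THE MAP (4.2) on the REAL `Ω = colim_K Hom_E(A_K, B)_ℚ`** (`RestOne.ΩOf C B S`, [Liu2021] Rem. 4.17: «the canonical map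
`Hom_E(A_∞, A_μ)_ℚ → Ω(μ)` is an isomorphism»; proof of Thm. 4.18 l. 2248–2250: «identify `Ω(μ)` with `Hom_E(A_∞, A_μ)_ℚ` by Remark 4.17
… by pulling back»): `f ↦ f^*` with values in `Hom_ℚ(H¹_B(B; ℚ), H¹_{B,τ'}(A_∞, ℚ))`, DEFINED by the universal property from the level
pieces (`levelMap_pre`), additive.  (Its `M_μ`-linearity, Hecke-equivariance and faithfulness are the further laws `P_smul ∕ P_comm ∕
P_injective` of `Map43RationalData`, not constructed here.) [cite: Liu2021, Rem. 4.17 (FJcycle.tex l. 2226–2228) and proof of Thm. 4.18 (l. 2248–2250)] -/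
def PΩ : ΩOf C B S →+ (L →ₗ[ℚ] U) :=
  DirectLimit.liftAddMonoidHom (sys C B S) (fun i => Λ.levelMap (OrderDual.ofDual i)) fun i j hij t => by
    show Λ.levelMap (OrderDual.ofDual j) (preₛ B S (C.Atr (homOfLE _)) t) = _
    rw [preₛ_apply]
    exact Λ.levelMap_pre (homOfLE _) t

open scoped Classical in
/-- **The level-`K` law of (4.2)**: on the image of `Hom_E(A_K, B)_ℚ` under the canonical map `res_K` (l. 2070–2072), (4.2) is
`transK ∘ (·)^*` — pull-back along the real morphism followed by the structure map of the tower. [cite: Liu2021, §4.2 (FJcycle.tex l. 2070–2072), Rem. 4.17, proof of Thm. 4.18 (l. 2248–2250)] -/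
theorem PΩ_resOf (K : C5.SmallLevel C.S.K₀) (t : C.HomQ K B) :
    Λ.PΩ S (resOf C B S K t) = Λ.transKQ K ∘ₗ Λ.phiStarQHom K t :=
  DirectLimit.liftAddMonoidHom_of (sys C B S) _ _ (OrderDual.toDual K) t

open scoped Classical in
/-- The level-`K` law on a generator `q ⊗ φ`: `(4.2) (res_K (q ⊗ φ)) = q · (transK ∘ φ^*)`. [cite: Liu2021, proof of Thm. 4.18 (FJcycle.tex l. 2248–2250)] -/
theorem PΩ_resOf_tmul (K : C5.SmallLevel C.S.K₀) (q : ℚ) (φ : C.A K ⟶ B) :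
    Λ.PΩ S (resOf C B S K (q ⊗ₜ φ)) = q • (Λ.transKQ K ∘ₗ Λ.phiStarQ K φ) := by
  rw [PΩ_resOf, phiStarQHom_tmul, LinearMap.comp_smul]

end LevelwiseBettiPullback

end Levelwise

/-! ## §2  At the one-object rest `restOne`: (4.2) on `ΩOne` and its law in the `toThm418Data` currency -/

section OneObject

open Literature.NumberTheory.Automorphic Literature.NumberTheory.Automorphic.Liu2021 Literature.NumberTheory.Automorphic.Liu2021.AppendixC
open Literature.NumberTheory.Automorphic.Liu2021.AppendixC.RestOne

variable {F E : Type} [Field F] [NumberField F] [IsTotallyReal F] [Field E] [NumberField E] [Algebra F E]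
  [IsTotallyComplex E] [Algebra.IsQuadraticExtension F E] [IsCMField E]
variable {P5 : PropC5Data F E} {isotropicAt : ℕ → Prop} (C : Sec42Data P5 isotropicAt)
variable {Lg : Type} [Field Lg] [NumberField Lg] [IsGalois ℚ Lg] (emb : E →ₐ[ℚ] Lg) (ιg : Lg →+* ℂ)
variable {μ : IdeleClassGroup E →ₜ* Circle} (hμ : IdeleClassGroup.IsConjugateSymplectic E μ)
  (hw : IdeleClassGroup.HasWeight E μ 1) (Car : Def45.Carriers E μ)
variable {L : Type} [AddCommGroup L] [Module ℚ L] {U : Type} [AddCommGroup U] [Module ℚ U]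

open scoped Classical in
/-- **(4.2) on the one-object rest's `Ω(μ) = ΩOne`** («Take an arbitrary object `D_μ ∈ 𝒜(μ)`», proof of Thm. 4.18 l. 2248; `ΩOne` is the
product over the subsingleton `ObjOne` of the colimits `Hom_E(A_∞, A_μ)_ℚ`, all factors definitionally equal): evaluate at the chosen
object `D` and apply `PΩ` for `B := A_μ = AμOne D` with «`M_μ` acting via `i_μ`» (`endScalarOne`). [cite: Liu2021, proof of Thm. 4.18 (FJcycle.tex l. 2248–2250); Rem. 4.17] -/
def PΩOne (D : ObjOne emb ιg hμ hw Car) (Λ : LevelwiseBettiPullback C (AμOne emb ιg hμ hw Car D) L U) :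
    ΩOne C emb ιg hμ hw Car →+ (L →ₗ[ℚ] U) where
  toFun ω := Λ.PΩ (fieldOfValues E μ) (ω D)
  map_zero' := by rw [Pi.zero_apply, map_zero]
  map_add' ω ω' := by rw [Pi.add_apply, map_add]

open scoped Classical in
/-- The level-`K` law at the one-object rest: `(4.2) (resOne K D t) = transK ∘ phiStarQHom K t`. [cite: Liu2021, §4.2 (FJcycle.tex l. 2070–2072), Rem. 4.17, proof of Thm. 4.18 (l. 2248–2250)] -/
theorem PΩOne_resOne (D : ObjOne emb ιg hμ hw Car) (Λ : LevelwiseBettiPullback C (AμOne emb ιg hμ hw Car D) L U)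
    (K : C5.SmallLevel C.S.K₀) (t : C.HomQ K (AμOne emb ιg hμ hw Car D)) :
    PΩOne C emb ιg hμ hw Car D Λ (resOne C emb ιg hμ hw Car K D t) = Λ.transKQ K ∘ₗ Λ.phiStarQHom K t :=
  Λ.PΩ_resOf (fieldOfValues E μ) K t

open scoped Classical in
/-- **The level-`K` law in the `Thm418Data` currency of the Δ2 junctions**: for the datum `toThm418Data C (restOne …)` (whose `Ω` IS `ΩOne`,
whose `Hom_E(A_K, A_μ)_ℚ` at a subgroup `K ≤ 𝔾(𝔸_F^∞)` IS `ℚ ⊗_ℤ Hom_E(A_{levelOf K}, A_μ)` and whose `res K D` IS `resOne (levelOf K) D`, all by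
`rfl` — `RestOne.homK_toThm418Data_restOne`), (4.2) of `res K D t` is `transK ∘ t^*` at the level `levelOf K`.
[cite: Liu2021, Thm. 4.18 (1) (FJcycle.tex l. 2239), Rem. 4.17, proof of Thm. 4.18 (l. 2248–2250)] -/
theorem PΩOne_res (Eps : Type) (epsOf : E → Eps) (Chi : Type) (omega : Eps → Chi → Type)
    [∀ ε χ, AddCommGroup (omega ε χ)] [∀ ε χ, Module ℂ (omega ε χ)] (rho : ∀ ε χ, Representation ℂ C.G (omega ε χ))
    (rhoΩ : Representation (fieldOfValues E μ) C.G (ΩOne C emb ιg hμ hw Car))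
    (D : ObjOne emb ιg hμ hw Car) (Λ : LevelwiseBettiPullback C (AμOne emb ιg hμ hw Car D) L U) (K : Subgroup C.G)
    (t : (toThm418Data C (restOne C emb ιg hμ hw Car Eps epsOf Chi omega rho rhoΩ)).HomK K D) :
    PΩOne C emb ιg hμ hw Car D Λ ((toThm418Data C (restOne C emb ιg hμ hw Car Eps epsOf Chi omega rho rhoΩ)).res K D t) =
      Λ.transKQ (C.levelOf K) ∘ₗ Λ.phiStarQHom (C.levelOf K) t :=
  PΩOne_resOne C emb ιg hμ hw Car D Λ (C.levelOf K) t

end OneObject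

/-! ## §3  S2 IN THE SKELETON'S SHAPE: `AK ∕ phiStar ∕ transK` and the law `P_eq` for a record whose `P` is `PΩOne` -/

section S2

open Literature.NumberTheory.Automorphic Literature.NumberTheory.Automorphic.Liu2021 Literature.NumberTheory.Automorphic.Liu2021.AppendixC
open Literature.NumberTheory.Automorphic.Liu2021.AppendixC.RestOne

variable {F E : Type} [Field F] [NumberField F] [IsTotallyReal F] [Field E] [NumberField E] [Algebra F E]
  [IsTotallyComplex E] [Algebra.IsQuadraticExtension F E] [IsCMField E]
variable {P5 : PropC5Data F E} {isotropicAt : ℕ → Prop} (C : Sec42Data P5 isotropicAt)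
variable {Lg : Type} [Field Lg] [NumberField Lg] [IsGalois ℚ Lg] (emb : E →ₐ[ℚ] Lg) (ιg : Lg →+* ℂ)
variable {μ : IdeleClassGroup E →ₜ* Circle} (hμ : IdeleClassGroup.IsConjugateSymplectic E μ)
  (hw : IdeleClassGroup.HasWeight E μ 1) (Car : Def45.Carriers E μ)
variable (Eps : Type) (epsOf : E → Eps) (Chi : Type) (omega : Eps → Chi → Type)
  [∀ ε χ, AddCommGroup (omega ε χ)] [∀ ε χ, Module ℂ (omega ε χ)] (rho : ∀ ε χ, Representation ℂ C.G (omega ε χ))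
  (rhoΩ : Representation (fieldOfValues E μ) C.G (ΩOne C emb ιg hμ hw Car))

open scoped Classical in
/-- **Δ2 SKELETON, sublemma S2 (`P_eq`) — for every record `M` of the proof's objects over `toThm418Data C (restOne …)` whose pull-back
field `P` is the CONSTRUCTED (4.2) `PΩOne` (`hMP`; at the pin a `rfl` once `M` is built with it):** with
`AK := ℂ ⊗_ℚ AKQ (levelOf K)` (`H¹_B(A_K ⊗ ℂ; ℂ)`), `phiStar φ := (phiStarQHom (levelOf K) φ) ⊗ ℂ` (Betti pull-back along the REAL `φ`,
complexified) and `transK := M.ι ∘ ((transKQ (levelOf K)) ⊗ ℂ)` (pull-back along `A_∞ → A_K` into `H¹_{B,τ'}(A_∞, ℂ) = M.HB`), the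
skeleton's law holds: `M.ι ((M.P (res K M.Dμ φ)) ⊗_ℂ α) = transK (phiStar φ α)` — VERBATIM the field `HcmPieces.P_eq` of
`HOME/d2bridge/HcmSkeleton.lean` at these three fields.  Proof: `PΩOne_res` + `LinearMap.baseChange_comp`.  HC_CM is NOT proved; no pin is
discharged; «Δ2 BRIDGE CLOSED» is NOT claimed. [cite: Liu2021, Rem. 4.17 (FJcycle.tex l. 2226–2228), Thm. 4.18 (1) (l. 2239), proof of Thm. 4.18 map (4.2)/(4.3) (l. 2247–2253)] -/
theorem map42_P_eq
    (M : (toThm418Data C (restOne C emb ιg hμ hw Car Eps epsOf Chi omega rho rhoΩ)).Map43RationalData)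
    (Λ : LevelwiseBettiPullback C (AμOne emb ιg hμ hw Car M.Dμ) M.L M.U)
    (hMP : M.P = PΩOne C emb ιg hμ hw Car M.Dμ Λ) (K : Subgroup C.G)
    (φ : (toThm418Data C (restOne C emb ιg hμ hw Car Eps epsOf Chi omega rho rhoΩ)).HomK K M.Dμ) :
    M.ι ((M.P ((toThm418Data C (restOne C emb ιg hμ hw Car Eps epsOf Chi omega rho rhoΩ)).res K M.Dμ φ)).baseChange ℂ M.α) =
      (M.ι ∘ₗ (Λ.transKQ (C.levelOf K)).baseChange ℂ) (((Λ.phiStarQHom (C.levelOf K) φ).baseChange ℂ) M.α) := by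
  -- the level-`K` law of the constructed (4.2), moved onto `M.P` along `hMP` (the domain `D.Ω` of `M.P` is `ΩOne` by `rfl`)
  have hP : M.P ((toThm418Data C (restOne C emb ιg hμ hw Car Eps epsOf Chi omega rho rhoΩ)).res K M.Dμ φ) =
      Λ.transKQ (C.levelOf K) ∘ₗ Λ.phiStarQHom (C.levelOf K) φ := by
    rw [hMP]
    exact PΩOne_res C emb ιg hμ hw Car Eps epsOf Chi omega rho rhoΩ M.Dμ Λ K φ
  rw [hP, LinearMap.baseChange_comp, LinearMap.comp_apply, LinearMap.comp_apply]

end S2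

end Summit.HodgeConjecture.CorCM.D2Bridge

end
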